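import Mathlib
import Summits.AnomalousDissipation.AnomalousDissipation.Theorems.SoloBlindLaplaceOfExp

/-!
# Solo-blind kernel #286 — Duhamel formula and the abscissa-based error bound (Galerkin route)

For a bounded generator `A : V →L[ℂ] V` on a complex Banach space with the growth bound
`‖e^{τA}‖ ≤ K e^{γτ}` (`τ ≥ 0`; #274/#275/#281 certify `γ` from the numerical abscissa, UNIFORMLY in the
truncation size), a solution of the forced linear equation `u′(s) = A u(s) + f(s)` satisfies the
Duhamel formula `u(t) = e^{tA}u(0) + ∫₀ᵗ e^{(t−s)A} f(s) ds` and hence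
`‖u(t)‖ ≤ K e^{γt}‖u(0)‖ + ∫₀ᵗ K e^{γ(t−s)}‖f(s)‖ ds`.  Applied to the Galerkin error
`e_J = P_J u − u_J` (forcing = truncation residual) this gives `u_J(t) → P_∞u(t)`, i.e. the truncated
read-out kernels converge to the physical one; #285 (Fatou) then transfers the [A′] mass bound.
The orbit `orbit A t = exp (t•A)` and its calculus are those of #270.
-/

namespace Summit.AnomalousDissipation.SoloBlind.DuhamelBound

open MeasureTheory Set
open Summit.AnomalousDissipation.SoloBlind.LaplaceOfExp

variable {V : Type*} [NormedAddCommGroup V] [NormedSpace ℂ V] [CompleteSpace V]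

/-- Derivative of `s ↦ e^{(t−s)A}`: `−A e^{(t−s)A}`. -/
theorem hasDerivAt_orbit_sub (A : V →L[ℂ] V) (t s : ℝ) :
    HasDerivAt (fun σ : ℝ => orbit A (t - σ)) (-(A * orbit A (t - s))) s := by
  have h1 : HasDerivAt (fun σ : ℝ => t - σ) (-1) s := by
    simpa using (hasDerivAt_id s).const_sub t
  have h2 := (hasDerivAt_orbit A (t - s)).scomp s h1
  simpa [Function.comp_def] using h2

/-- The same for the `ℝ`-restricted operators (the form `HasDerivAt.clm_apply` consumes). -/
theorem hasDerivAt_orbit_sub_restrict (A : V →L[ℂ] V) (t s : ℝ) :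
    HasDerivAt (fun σ : ℝ => (orbit A (t - σ)).restrictScalars ℝ)
      ((-(A * orbit A (t - s))).restrictScalars ℝ) s := by
  have h := (ContinuousLinearMap.restrictScalarsL ℂ V V ℝ ℝ).hasFDerivAt.comp_hasDerivAt s
    (hasDerivAt_orbit_sub A t s)
  simpa [Function.comp_def] using h

omit [CompleteSpace V] in
/-- `A` commutes with `e^{τA}` on vectors. -/
theorem apply_orbit_comm (A : V →L[ℂ] V) (τ : ℝ) (v : V) :
    A (orbit A τ v) = orbit A τ (A v) := by
  have h := commute_orbit A τ
  have := congrArg (fun T : V →L[ℂ] V => T v) h.eq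
  simpa using this

/-- Derivative of the Duhamel integrand `φ(s) = e^{(t−s)A} u(s)` along a solution of
`u′ = A u + f`: `φ′(s) = e^{(t−s)A} f(s)`. -/
theorem hasDerivAt_duhamel {A : V →L[ℂ] V} {u f : ℝ → V} (t s : ℝ)
    (hu : HasDerivAt u (A (u s) + f s) s) :
    HasDerivAt (fun σ : ℝ => orbit A (t - σ) (u σ)) (orbit A (t - s) (f s)) s := by
  have h := (hasDerivAt_orbit_sub_restrict A t s).clm_apply hu
  -- h : HasDerivAt (fun y => (orbit A (t-y)).restrictScalars ℝ (u y))
  --       ((-(A * orbit A (t-s))).restrictScalars ℝ (u s) + (orbit A (t-s)).restrictScalars ℝ (A (u s) + f s)) s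
  have h' : HasDerivAt (fun σ : ℝ => orbit A (t - σ) (u σ))
      ((-(A * orbit A (t - s))) (u s) + orbit A (t - s) (A (u s) + f s)) s := by
    simpa only [ContinuousLinearMap.coe_restrictScalars'] using h
  refine h'.congr_deriv ?_
  rw [show (-(A * orbit A (t - s))) (u s) = -(A (orbit A (t - s) (u s))) from rfl, map_add,
    apply_orbit_comm]
  abel

/-- Continuity of the Duhamel integrand `s ↦ e^{(t−s)A} f(s)` for continuous `f`. -/
theorem continuous_duhamel_integrand (A : V →L[ℂ] V) {f : ℝ → V} (hf : Continuous f) (t : ℝ) :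
    Continuous (fun s : ℝ => orbit A (t - s) (f s)) :=
  ((continuous_orbit A).comp (continuous_const.sub continuous_id)).clm_apply hf

/-- **Duhamel formula.**  `u′ = A u + f` (everywhere), `f` continuous ⇒
`u(t) = e^{tA} u(0) + ∫₀ᵗ e^{(t−s)A} f(s) ds`. -/
theorem duhamel {A : V →L[ℂ] V} {u f : ℝ → V}
    (hu : ∀ s, HasDerivAt u (A (u s) + f s) s) (hf : Continuous f) (t : ℝ) :
    u t = orbit A t (u 0) + ∫ s in (0 : ℝ)..t, orbit A (t - s) (f s) := by
  have hint : IntervalIntegrable (fun s : ℝ => orbit A (t - s) (f s)) volume 0 t :=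
    (continuous_duhamel_integrand A hf t).intervalIntegrable (μ := volume) 0 t
  have hftc := intervalIntegral.integral_eq_sub_of_hasDerivAt
    (fun s _ => hasDerivAt_duhamel (A := A) t s (hu s)) hint
  -- hftc : ∫ s in 0..t, orbit A (t-s) (f s) = orbit A (t-t) (u t) - orbit A (t-0) (u 0)
  rw [hftc, sub_self, sub_zero, orbit_zero]
  change u t = orbit A t (u 0) + (u t - orbit A t (u 0))
  abel

/-- **Duhamel bound from the growth abscissa.**  With `‖e^{τA}‖ ≤ K e^{γτ}` for `τ ≥ 0` and `t ≥ 0`: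
`‖u(t)‖ ≤ K e^{γt}‖u(0)‖ + ∫₀ᵗ K e^{γ(t−s)}‖f(s)‖ ds`. -/
theorem duhamel_bound {A : V →L[ℂ] V} {u f : ℝ → V} {K γ t : ℝ}
    (hK : ∀ τ : ℝ, 0 ≤ τ → ‖orbit A τ‖ ≤ K * Real.exp (γ * τ))
    (hu : ∀ s, HasDerivAt u (A (u s) + f s) s) (hf : Continuous f) (ht : 0 ≤ t) :
    ‖u t‖ ≤ K * Real.exp (γ * t) * ‖u 0‖ +
      ∫ s in (0 : ℝ)..t, K * Real.exp (γ * (t - s)) * ‖f s‖ := by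
  rw [duhamel hu hf t]
  refine le_trans (norm_add_le _ _) (add_le_add ?_ ?_)
  · exact le_trans (ContinuousLinearMap.le_opNorm _ _)
      (mul_le_mul_of_nonneg_right (hK t ht) (norm_nonneg _))
  · refine le_trans (intervalIntegral.norm_integral_le_integral_norm ht) ?_
    refine intervalIntegral.integral_mono_on ht ?_ ?_ fun s hs => ?_
    · exact (continuous_duhamel_integrand A hf t).norm.intervalIntegrable (μ := volume) 0 t
    · exact (by fun_prop : Continuous fun s : ℝ => K * Real.exp (γ * (t - s)) * ‖f s‖)
        |>.intervalIntegrable (μ := volume) 0 t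
    · exact le_trans (ContinuousLinearMap.le_opNorm _ _)
        (mul_le_mul_of_nonneg_right (hK (t - s) (by linarith [hs.2])) (norm_nonneg _))

/-- **Galerkin error form.**  Zero initial error: `‖e(t)‖ ≤ ∫₀ᵗ K e^{γ(t−s)}‖r(s)‖ ds`, and with a
uniform residual bound `‖r(s)‖ ≤ ρ` on `[0,t]` and `γ ≠ 0`: `‖e(t)‖ ≤ K ρ (e^{γt} − 1)/γ`. -/
theorem galerkin_error_le {A : V →L[ℂ] V} {e r : ℝ → V} {K γ t ρ : ℝ}
    (hK : ∀ τ : ℝ, 0 ≤ τ → ‖orbit A τ‖ ≤ K * Real.exp (γ * τ))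
    (he : ∀ s, HasDerivAt e (A (e s) + r s) s) (hr : Continuous r) (he0 : e 0 = 0) (ht : 0 ≤ t)
    (hKnn : 0 ≤ K) (hρ : ∀ s ∈ Icc 0 t, ‖r s‖ ≤ ρ) (hγ : γ ≠ 0) :
    ‖e t‖ ≤ K * ρ * ((Real.exp (γ * t) - 1) / γ) := by
  have h1 := duhamel_bound hK he hr ht
  rw [he0, norm_zero, mul_zero, zero_add] at h1
  refine le_trans h1 ?_
  have hmono : ∫ s in (0 : ℝ)..t, K * Real.exp (γ * (t - s)) * ‖r s‖
      ≤ ∫ s in (0 : ℝ)..t, K * ρ * Real.exp (γ * (t - s)) := by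
    refine intervalIntegral.integral_mono_on ht ?_ ?_ fun s hs => ?_
    · exact (by fun_prop : Continuous fun s : ℝ => K * Real.exp (γ * (t - s)) * ‖r s‖)
        |>.intervalIntegrable (μ := volume) 0 t
    · exact (by fun_prop : Continuous fun s : ℝ => K * ρ * Real.exp (γ * (t - s)))
        |>.intervalIntegrable (μ := volume) 0 t
    · have := hρ s hs
      have hE : 0 ≤ K * Real.exp (γ * (t - s)) := mul_nonneg hKnn (Real.exp_pos _).le
      nlinarith
  refine le_trans hmono (le_of_eq ?_)
  have hderiv : ∀ s ∈ Set.uIcc 0 t,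
      HasDerivAt (fun σ : ℝ => -(Real.exp (γ * (t - σ)) / γ)) (Real.exp (γ * (t - s))) s := by
    intro s _
    have h0 : HasDerivAt (fun σ : ℝ => γ * (t - σ)) (-γ) s := by
      simpa using ((hasDerivAt_id s).const_sub t).const_mul γ
    have h := (h0.exp.div_const γ).neg
    refine h.congr_deriv ?_
    rw [mul_neg, neg_div, neg_neg, mul_div_assoc, div_self hγ, mul_one]
  have hcont : IntervalIntegrable (fun s : ℝ => Real.exp (γ * (t - s))) volume 0 t :=
    (by fun_prop : Continuous fun s : ℝ => Real.exp (γ * (t - s))).intervalIntegrable (μ := volume) 0 t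
  have hI := intervalIntegral.integral_eq_sub_of_hasDerivAt hderiv hcont
  rw [intervalIntegral.integral_const_mul, hI]
  simp only [sub_self, mul_zero, Real.exp_zero, sub_zero]
  field_simp
  ring

end Summit.AnomalousDissipation.SoloBlind.DuhamelBound
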